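import Summits.HodgeConjecture.CorCM.IrreducibleOddWeightsIsotypicFrobeniusRegular
import Summits.HodgeConjecture.CorCM.IrreducibleOddWeightsOrbitBalanceCMFields
import HarnessLib

/-!
# Isotypic cells, Frobenius XI: GALOIS FIELDS — for `K/ℚ` normal the permutation module `ℚ^{Hom(K, ℂ)}` has
# regular multiplicities (`m_c·δ_c = dim A_c` for every occurring class) and `Σ_c m_c²·δ_c = [K : ℚ]`

COR-CM (cell `pub-hodgecm2`, binder seat `b16` gen 77, count-neutral claim FROBENIUS RECIPROCITY IN THE REFERENCE
CURRENCY — MULTIPLICITIES FROM FIXED POINTS, file R11 — the hypothesis-free Galois case of files R9/R10; theorems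
only, no definition, no named fact, no `sorry`).  NEW as stated, hence under `Summits/`.  HONEST FRAMING: for a
NORMAL number field every complex embedding has the same image (lane `apply_mem_range_of_normal`, gen 6x), so the
stabiliser `Aut(ℂ/x₀K)` of one embedding fixes `Hom(K, ℂ)` pointwise and files R10 (regular multiplicities) and
R9 (orbit count) apply with no further input: the `Aut(ℂ)`-module `ℚ^{Hom(K, ℂ)}` of a Galois field is the regular
representation of `Gal(K/ℚ)` seen abstractly — every occurring irreducible `A_c` occurs `dim A_c/δ_c` times and
`[K : ℚ] = Σ_c m_c²·δ_c` (`= Σ_c dim A_c²/δ_c` over the occurring classes, Wedderburn's count `|G| = Σ n_c²·dim D_c`).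
Nothing about Hodge classes is asserted; `HC_CM` is neither used nor asserted.

* §1 `smul_eq_of_normal` (the stabiliser of one embedding of a normal `K` fixes every embedding; the lane's
  `apply_mem_range_of_normal`).
* §2 **`exists_isotypic_card_mul_eq_finrank_of_normal`**: for number fields `K_i`, an `Aut(ℂ)`-isotypic
  decomposition of `⊕_i ℚ^{Hom(K_i, ℂ)}` in which every NORMAL `K_i` has `m_{i,c}·δ_c = dim A_c` whenever `m_{i,c} ≠ 0`.
* §3 **`exists_isotypic_sum_card_sq_mul_eq_finrank_of_normal`**: … and (another decomposition witness) every normal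
  `K_i` has `Σ_c m_{i,c}²·δ_c = [K_i : ℚ]`.

## References

* [Serre1977] J.-P. Serre, *Linear Representations of Finite Groups*, GTM 42, §2.4 Cor. 1–2 (the regular
  representation), §12.1 (over `ℚ`).
* [Lang2002] S. Lang, *Algebra*, 3rd ed., V §3 Thm. 3.3 (normal extensions: all embeddings have the same image),
  XVII §3–§4 (semisimple rings, `|G| = Σ n_i² dim D_i`).
* [LangeRodriguez2022] H. Lange, R. E. Rodríguez, *Decomposition of Jacobians by Prym Varieties*, LNM 2310 (2022),
  §2.8 (2.21)–(2.23).
-/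

set_option autoImplicit false

noncomputable section

open scoped BigOperators Classical

namespace Summit.HodgeConjecture.CorCM

open NumberField
open Literature.NumberTheory.ComplexMultiplication
open Literature.AlgebraicGeometry.Pohlmann1968

/-! ### §1 Normal fields: one image, one stabiliser -/

section Normal

variable {K : Type} [Field K] [NumberField K]

/-- **FOR A NORMAL FIELD THE STABILISER OF ONE EMBEDDING FIXES EVERY EMBEDDING.** [cite: Lang2002, V §3 Thm. 3.3] -/
theorem smul_eq_of_normal [Normal ℚ K] (k : ℂ ≃+* ℂ) (x : K →+* ℂ) (hk : k • x = x) (y : K →+* ℂ) :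
    k • y = y := by
  rw [smul_embedding_eq_self_iff] at hk ⊢
  intro a
  obtain ⟨b, hb⟩ := apply_mem_range_of_normal x y a
  rw [← hb, hk b]

end Normal

/-! ### §2 Regular multiplicities for normal fields -/

variable {I : Type} [Fintype I] {K : I → Type} [∀ i, Field (K i)] [∀ i, NumberField (K i)]

/-- **A NORMAL NUMBER FIELD HAS REGULAR MULTIPLICITIES**: for number fields `K_i` there is an `Aut(ℂ)`-isotypic
decomposition `ℚ^{Hom(K_i, ℂ)} ≅ ⊕_c A_c^{m_{i,c}}` (pairwise non-embeddable irreducibles `A_c`, commutants `𝒟_c`,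
non-zero `a₀_c`, `δ_c = dim 𝒟_c·a₀_c`) such that for every `i` with `K_i/ℚ` NORMAL and every class,
**`m_{i,c} ≠ 0 ⟹ m_{i,c}·δ_c = dim A_c`** (file R10 + §1). [cite: Serre1977, §2.4 Cor. 1 and §12.1]
[cite: LangeRodriguez2022, §2.8 (2.21)–(2.23)] -/
theorem exists_isotypic_card_mul_eq_finrank_of_normal :
    ∃ (n : ℕ) (Ar : Fin n → Submodule ℚ ((Σ i, (K i →+* ℂ)) → ℚ))
      (𝒟 : Fin n → Submodule ℚ (((Σ i, (K i →+* ℂ)) → ℚ) →ₗ[ℚ] ((Σ i, (K i →+* ℂ)) → ℚ)))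
      (m : I → Fin n → ℕ)
      (ι : ∀ (i : I) (c : Fin n), Fin (m i c) → (((Σ i, (K i →+* ℂ)) → ℚ) →ₗ[ℚ] ((K i →+* ℂ) → ℚ)))
      (a₀ : Fin n → ((Σ i, (K i →+* ℂ)) → ℚ)),
      (∀ (c : Fin n) (L : ((Σ i, (K i →+* ℂ)) → ℚ) →ₗ[ℚ] ((Σ i, (K i →+* ℂ)) → ℚ)), L ∈ 𝒟 c ↔
        (∀ a ∈ Ar c, L a ∈ Ar c) ∧ ∀ (k : ℂ ≃+* ℂ) (a : (Σ i, (K i →+* ℂ)) → ℚ), a ∈ Ar c →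
          L (fun x => a (k • x)) = fun x => L a (k • x)) ∧
      (∀ (c : Fin n) (k : ℂ ≃+* ℂ) (a : (Σ i, (K i →+* ℂ)) → ℚ), a ∈ Ar c → (fun x => a (k • x)) ∈ Ar c) ∧
      (∀ (c : Fin n) (W : Submodule ℚ ((Σ i, (K i →+* ℂ)) → ℚ)), W ≤ Ar c → W ≠ ⊥ →
        (∀ (k : ℂ ≃+* ℂ) (f : (Σ i, (K i →+* ℂ)) → ℚ), f ∈ W → (fun x => f (k • x)) ∈ W) → W = Ar c) ∧
      (∀ c : Fin n, Ar c ≠ ⊥) ∧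
      (∀ (c c' : Fin n) (L : ((Σ i, (K i →+* ℂ)) → ℚ) →ₗ[ℚ] ((Σ i, (K i →+* ℂ)) → ℚ)), c ≠ c' → Ar c ≠ ⊥ →
        (∀ a ∈ Ar c, L a ∈ Ar c') → (∀ a ∈ Ar c, L a = 0 → a = 0) →
        (∀ (k : ℂ ≃+* ℂ) (a : (Σ i, (K i →+* ℂ)) → ℚ), a ∈ Ar c →
          L (fun x => a (k • x)) = fun x => L a (k • x)) → False) ∧
      (∀ (i : I) (c : Fin n) (j : Fin (m i c)) (k : ℂ ≃+* ℂ) (a : (Σ i, (K i →+* ℂ)) → ℚ), a ∈ Ar c →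
        ι i c j (fun x => a (k • x)) = fun s => ι i c j a (k • s)) ∧
      (∀ (i : I) (c : Fin n) (j : Fin (m i c)) (a : (Σ i, (K i →+* ℂ)) → ℚ), a ∈ Ar c →
        ι i c j a = 0 → a = 0) ∧
      (∀ i : I, iSupIndep fun q : (Σ c : Fin n, Fin (m i c)) => (Ar q.1).map (ι i q.1 q.2)) ∧
      (∀ i : I, (⨆ c : Fin n, ⨆ j : Fin (m i c), (Ar c).map (ι i c j)) = ⊤) ∧
      (∀ c, a₀ c ∈ Ar c) ∧ (∀ c, a₀ c ≠ 0) ∧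
      ∀ i : I, Normal ℚ (K i) → ∀ c, m i c ≠ 0 →
        m i c * Module.finrank ℚ ↥((𝒟 c).map (LinearMap.applyₗ (a₀ c))) = Module.finrank ℚ (Ar c) := by
  obtain ⟨n, Ar, 𝒟, m, ι, a₀, h𝒟, hRst, hRirr, hR0, hsep, hιeq, hinj, hindep, htop, ha₀, h0, hreg⟩ :=
    exists_isotypic_card_mul_eq_finrank_of_same_range (K := K)
  refine ⟨n, Ar, 𝒟, m, ι, a₀, h𝒟, hRst, hRirr, hR0, hsep, hιeq, hinj, hindep, htop, ha₀, h0, fun i hN c hc => ?_⟩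
  haveI := hN
  exact hreg i (fun x y a => apply_mem_range_of_normal x y a) c hc

/-! ### §3 The Hecke count of a normal field is its degree -/

/-- **`Σ_c m_{i,c}²·δ_c = [K_i : ℚ]` FOR A NORMAL `K_i`**: an `Aut(ℂ)`-isotypic decomposition of `⊕_i ℚ^{Hom(K_i, ℂ)}`
(as above) in which every normal member satisfies Wedderburn's count — the `Aut(ℂ/x₀K_i)`-orbits on `Hom(K_i, ℂ)` are
singletons (§1 + file R10 §1), and their number is `Σ_c m_{i,c}²·δ_c` (file R9). [cite: Lang2002, XVII §3–§4]
[cite: Serre1977, §2.4 Cor. 2 and §12.1] -/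
theorem exists_isotypic_sum_card_sq_mul_eq_finrank_of_normal :
    ∃ (n : ℕ) (Ar : Fin n → Submodule ℚ ((Σ i, (K i →+* ℂ)) → ℚ))
      (𝒟 : Fin n → Submodule ℚ (((Σ i, (K i →+* ℂ)) → ℚ) →ₗ[ℚ] ((Σ i, (K i →+* ℂ)) → ℚ)))
      (m : I → Fin n → ℕ)
      (ι : ∀ (i : I) (c : Fin n), Fin (m i c) → (((Σ i, (K i →+* ℂ)) → ℚ) →ₗ[ℚ] ((K i →+* ℂ) → ℚ)))
      (a₀ : Fin n → ((Σ i, (K i →+* ℂ)) → ℚ)),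
      (∀ (c : Fin n) (L : ((Σ i, (K i →+* ℂ)) → ℚ) →ₗ[ℚ] ((Σ i, (K i →+* ℂ)) → ℚ)), L ∈ 𝒟 c ↔
        (∀ a ∈ Ar c, L a ∈ Ar c) ∧ ∀ (k : ℂ ≃+* ℂ) (a : (Σ i, (K i →+* ℂ)) → ℚ), a ∈ Ar c →
          L (fun x => a (k • x)) = fun x => L a (k • x)) ∧
      (∀ (c : Fin n) (k : ℂ ≃+* ℂ) (a : (Σ i, (K i →+* ℂ)) → ℚ), a ∈ Ar c → (fun x => a (k • x)) ∈ Ar c) ∧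
      (∀ (c : Fin n) (W : Submodule ℚ ((Σ i, (K i →+* ℂ)) → ℚ)), W ≤ Ar c → W ≠ ⊥ →
        (∀ (k : ℂ ≃+* ℂ) (f : (Σ i, (K i →+* ℂ)) → ℚ), f ∈ W → (fun x => f (k • x)) ∈ W) → W = Ar c) ∧
      (∀ c : Fin n, Ar c ≠ ⊥) ∧
      (∀ (c c' : Fin n) (L : ((Σ i, (K i →+* ℂ)) → ℚ) →ₗ[ℚ] ((Σ i, (K i →+* ℂ)) → ℚ)), c ≠ c' → Ar c ≠ ⊥ →
        (∀ a ∈ Ar c, L a ∈ Ar c') → (∀ a ∈ Ar c, L a = 0 → a = 0) →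
        (∀ (k : ℂ ≃+* ℂ) (a : (Σ i, (K i →+* ℂ)) → ℚ), a ∈ Ar c →
          L (fun x => a (k • x)) = fun x => L a (k • x)) → False) ∧
      (∀ (i : I) (c : Fin n) (j : Fin (m i c)) (k : ℂ ≃+* ℂ) (a : (Σ i, (K i →+* ℂ)) → ℚ), a ∈ Ar c →
        ι i c j (fun x => a (k • x)) = fun s => ι i c j a (k • s)) ∧
      (∀ (i : I) (c : Fin n) (j : Fin (m i c)) (a : (Σ i, (K i →+* ℂ)) → ℚ), a ∈ Ar c →
        ι i c j a = 0 → a = 0) ∧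
      (∀ i : I, iSupIndep fun q : (Σ c : Fin n, Fin (m i c)) => (Ar q.1).map (ι i q.1 q.2)) ∧
      (∀ i : I, (⨆ c : Fin n, ⨆ j : Fin (m i c), (Ar c).map (ι i c j)) = ⊤) ∧
      (∀ c, a₀ c ∈ Ar c) ∧ (∀ c, a₀ c ≠ 0) ∧
      ∀ i : I, Normal ℚ (K i) →
        ∑ c, m i c ^ 2 * Module.finrank ℚ ↥((𝒟 c).map (LinearMap.applyₗ (a₀ c))) = Module.finrank ℚ (K i) := by
  haveI : ∀ i, Nonempty (K i →+* ℂ) := fun i => inferInstance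
  obtain ⟨n, Ar, 𝒟, m, ι, a₀, h𝒟, hRst, hRirr, hR0, hsep, hιeq, hinj, hindep, htop, ha₀, h0, horb⟩ :=
    exists_isotypic_card_orbitRel_quotient_eq_sum_numberField (K := K)
  refine ⟨n, Ar, 𝒟, m, ι, a₀, h𝒟, hRst, hRirr, hR0, hsep, hιeq, hinj, hindep, htop, ha₀, h0, fun i hN => ?_⟩
  haveI := hN
  obtain ⟨x₀⟩ := (inferInstance : Nonempty (K i →+* ℂ))
  have hfix : ∀ k : ℂ ≃+* ℂ, k • x₀ = x₀ → ∀ y : K i →+* ℂ, k • y = y := fun k hk y => smul_eq_of_normal k x₀ hk y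
  have h1 := horb i i x₀
  rw [IrrOdd.card_orbitRel_quotient_eq_card_of_forall_fix hfix, Embeddings.card (K i) ℂ] at h1
  rw [h1]
  exact Finset.sum_congr rfl fun c _ => by rw [sq]

end Summit.HodgeConjecture.CorCM

end
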